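import Summits.HodgeConjecture.HodgeConjecture.Theses.LinearSystemTorelli
import Literature.AlgebraicGeometry.FundamentalGroup.RiemannExistenceSmoothAffine
import HarnessLib

/-!
# Crux `MiddleDivisorSupportFourfold` (stmt-HodgeConjecture-2409), line `IdeatorFiveSketch` — registered
# stub `stub_locallyAlgebraicSeparatingSmoothAffineDimGeTwo`, CLOSED by the tree's Riemann-existence core

Route `LinearSystemTorelli` of `HodgeConjecture`. The registered skeleton of crux
`MiddleDivisorSupportFourfold` carries, under the same name and with the same signature as crux `Envelope`
(stmt-HodgeConjecture-1069, route `QbarEnvelope`), the stub isolating the transcendental input of Riemann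
existence with `ℚ̄`-descent in relative dimension `≥ 2`: a locally algebraic separating function for a
finite topological covering of a smooth irreducible affine `ℂ`-scheme of relative dimension `n + 2`. It is
the tree theorem `FundamentalGroup.SmoothAffine.exists_locallyAlgebraicSeparating` (2026-08-17) specialised
to relative dimension `n + 2`, recorded for crux `Envelope` as
`Theorems.Envelope.stub_locallyAlgebraicSeparatingSmoothAffineDimGeTwo` (companion file
`QbarEnvelopeEnvelopeStubLocallyAlgebraicSeparating`); this file records the same registered signature for
this crux's ledger entry (smoothness read off `SmoothOfRelativeDimension.smooth`). No mathematics beyond the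
citation of the tree theorem.

## References

* [SGA1] A. Grothendieck, M. Raynaud, Revêtements étales et groupe fondamental (SGA 1), LNM 224 (1971),
  Exp. XII Thm. 5.1, Exp. XIII Cor. 4.6.
-/

noncomputable section

-- `Summit.HodgeConjecture.HodgeConjecture.…` is the mandated namespace (single-conjunct summit).
set_option linter.dupNamespace false

namespace Summit.HodgeConjecture.HodgeConjecture.Theorems.MiddleDivisorSupportFourfold

open AlgebraicGeometry Literature.AlgebraicGeometry.Motives

/-- **Registered stub `stub_locallyAlgebraicSeparatingSmoothAffineDimGeTwo` of crux
`MiddleDivisorSupportFourfold`** (stmt-HodgeConjecture-2409), verbatim: for a smooth irreducible affine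
`ℂ`-scheme `S` of relative dimension `n + 2`, a finite topological covering `q : T → S(ℂ)` and
`P₀ ∈ S(ℂ)`, there are an affine open `U ∋ P₀`, `h : T → ℂ` continuous on `q⁻¹(U)` and a non-zero
polynomial `F` over `Γ(S, U)` with `F(q t)(h t) = 0` for `q t ∈ U` and `h` injective on `q⁻¹(P₀)`.
[cite: SGA1, Exp. XII Thm. 5.1] [cite: HatcherAT2002, Thm. 1.38] -/
theorem stub_locallyAlgebraicSeparatingSmoothAffineDimGeTwo :
    ∀ (n : ℕ) (S : SchemeOver ℂ), IsAffine S.left → SmoothOfRelativeDimension (n + 2) S.hom →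
      IrreducibleSpace S.left →
      ∀ (T : Type) [TopologicalSpace T] (q : T → ComplexPoints S) (_ : IsCoveringMap q)
        (_ : ∀ t, (q ⁻¹' {t}).Finite) (P₀ : ComplexPoints S),
        ∃ (U : S.left.Opens) (_ : IsAffineOpen U) (_ : P₀.pt ∈ U) (h : T → ℂ)
          (F : Polynomial Γ(S.left, U)),
          ContinuousOn h (q ⁻¹' {P | P.pt ∈ U}) ∧ F ≠ 0 ∧
          (∀ (t : T) (ht : (q t).pt ∈ U), (F.map ((q t).evalRingHom U ht)).eval (h t) = 0) ∧
          Set.InjOn h (q ⁻¹' {P₀}) := by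
  intro n S hAff hSm hIrr T _ q hq hfin P₀
  haveI := hAff
  haveI := hIrr
  haveI := hSm
  haveI : Smooth S.hom := SmoothOfRelativeDimension.smooth (n + 2) S.hom
  exact Literature.AlgebraicGeometry.FundamentalGroup.SmoothAffine.exists_locallyAlgebraicSeparating
    S T q hq hfin P₀

end Summit.HodgeConjecture.HodgeConjecture.Theorems.MiddleDivisorSupportFourfold

end
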